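import Literature.Analysis.FluidPDE.NSCoriolisTorus
import Literature.Analysis.FunctionSpaces.TorusInverseLaplacianCalculus
import HarnessLib

/-!
# The Coriolis term is `L²(𝕋³)`-orthogonal to the Laplacian

Analysis/FluidPDE proof file (theorems only; no definitions, no named facts), sequel of
`NSCoriolisTorus.lean`, supporting the named fact
`Literature.Analysis.FluidPDE.bmn1999_rotating_ns_global_regularity` (Babin–Mahalov–Nicolaenko,
Indiana Univ. Math. J. 48 (1999), Thm. 1.1). BMN 1999, p. 1140: "as `PJP` is skew-symmetric and
commutes with `A^α` for every `α`, `E(−Ωt) = exp(−ΩPJPt)` preserves all Sobolev norms" — the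
reason every `H^α` estimate of §§3–5 is uniform in `Ω`. This file proves the case `α = 1` (and
then every integer `α = n`) for smooth fields on the torus:

* `inner_coriolisForce_left_eq_neg` — bilinear skewness `⟪Ω e₃ × a, b⟫ = −⟪a, Ω e₃ × b⟫`;
* `Torus.integral_inner_coriolisForce_laplacian` — `∫_{𝕋³} ⟪Ω e₃ × u, Δu⟫ = 0` for smooth `u`
  (Green's second identity `Torus.integral_inner_laplacian_comm`, `Δ(J ∘ u) = J ∘ Δu` for the
  constant map `J = Ω e₃ ×`, `Torus.laplacian_clm_comp_apply`, and the skewness of `J`);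
* `IsClassicalNSCoriolisSolutionOn.integral_inner_coriolisForce_laplacian_eq_zero` — along a
  periodic classical solution of the rotating system the Coriolis term pairs to zero with
  `Δu(t)`: the enstrophy (`H¹`) balance of the rotating system is that of Navier–Stokes, as the
  energy balance is (`NSCoriolisTorus`).
* `Torus.integral_inner_coriolisForce_laplacian_iterate`,
  `IsClassicalNSCoriolisSolutionOn.integral_inner_coriolisForce_laplacian_iterate_eq_zero` —
  the same for every power `Δⁿ`, `n : ℕ` (all integer Sobolev levels `α = n`), by two-step
  induction from the cases `n = 0, 1` and Green's second identity.

## Mathlib / tree search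

Tree (reused): `coriolisForce`, `crossCLM`, `coriolisForce_eq_smul_crossCLM`,
`IsClassicalNSCoriolisSolutionOn.to_torus` (`NSCoriolis`, `NSCoriolisTorus`);
`Torus.integral_inner_laplacian_comm` (`TorusFluidGlueProofs`), `Torus.laplacian_clm_comp_apply`
(`TorusInverseLaplacianCalculus`), `Torus.IsSmooth.comp_clm` (`FlatTorus`). Mathlib: no
rotating-fluid notions.

## References

* A. Babin, A. Mahalov, B. Nicolaenko, *Global regularity of 3D rotating Navier–Stokes equations
  for resonant domains*, Indiana Univ. Math. J. 48 (1999) 1133–1176, §2, p. 1140.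
  [BabinMahalovNicolaenko1999]
-/

noncomputable section

open MeasureTheory Set Function
open scoped ContDiff Laplacian InnerProductSpace RealInnerProductSpace

namespace Literature.Analysis.FluidPDE

/-! ### The Coriolis term is `L²`-orthogonal to the Laplacian (no rotation in `H¹` estimates) -/

/-- **Bilinear skewness of the Coriolis force**: `⟪Ω e₃ × a, b⟫ = −⟪a, Ω e₃ × b⟫`
(antisymmetry of the scalar triple product). [folklore] -/
theorem inner_coriolisForce_left_eq_neg (Ω : ℝ) (a b : EuclideanSpace ℝ (Fin 3)) :
    ⟪coriolisForce Ω a, b⟫ = -⟪a, coriolisForce Ω b⟫ := by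
  have h : ⟪cross e₃ a, b⟫ = -⟪a, cross e₃ b⟫ := by
    simp only [cross, PiLp.inner_apply, cross_apply, RCLike.inner_apply, conj_trivial,
      Fin.sum_univ_three, Matrix.cons_val_zero, Matrix.cons_val_one, Matrix.cons_val_two,
      Matrix.tail_cons, Matrix.head_cons]
    ring
  rw [coriolisForce_def, coriolisForce_def, real_inner_smul_left, real_inner_smul_right, h,
    mul_neg]

/-- **The Coriolis term is `L²(𝕋³)`-orthogonal to the Laplacian**: `∫ ⟪Ω e₃ × u, Δu⟫ = 0` for
every smooth field `u` on the torus (BMN 1999, p. 1140: "as `PJP` is skew-symmetric and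
commutes with `A^α` for every `α`, `E(−Ωt) = exp(−ΩPJPt)` preserves all Sobolev norms"; this is
the case `α = 1`, by which the rotation drops out of the enstrophy balance exactly as it drops
out of the energy balance). Proof: with the constant map `J = Ω e₃ ×`, Green's second identity
gives `∫ ⟪Δ(Ju), u⟫ = ∫ ⟪Ju, Δu⟫` (`Torus.integral_inner_laplacian_comm`), while
`Δ(Ju) = J(Δu)` (`Torus.laplacian_clm_comp_apply`) and the pointwise skewness of `J`
(`inner_coriolisForce_left_eq_neg`) give `∫ ⟪Δ(Ju), u⟫ = −∫ ⟪Ju, Δu⟫`.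
[cite: BabinMahalovNicolaenko1999, §2 p. 1140] -/
theorem Torus.integral_inner_coriolisForce_laplacian (Ω : ℝ)
    {u : UnitAddTorus (Fin 3) → EuclideanSpace ℝ (Fin 3)} (hu : FunctionSpaces.Torus.IsSmooth u) :
    ∫ x, ⟪coriolisForce Ω (u x), FunctionSpaces.Torus.laplacian u x⟫ = 0 := by
  have hJu : FunctionSpaces.Torus.IsSmooth ((Ω • crossCLM e₃) ∘ u) := hu.comp_clm (Ω • crossCLM e₃)
  -- Green's second identity for the pair `(Ju, u)`
  have hG := FunctionSpaces.Torus.integral_inner_laplacian_comm hJu hu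
  -- `⟪Δ(Ju), u⟫ = -⟪Ju, Δu⟫` pointwise
  have hskew : ∀ x, ⟪FunctionSpaces.Torus.laplacian ((Ω • crossCLM e₃) ∘ u) x, u x⟫ =
      -⟪((Ω • crossCLM e₃) ∘ u) x, FunctionSpaces.Torus.laplacian u x⟫ := by
    intro x
    rw [FunctionSpaces.Torus.laplacian_clm_comp_apply hu, Function.comp_apply,
      ← coriolisForce_eq_smul_crossCLM, ← coriolisForce_eq_smul_crossCLM,
      inner_coriolisForce_left_eq_neg, real_inner_comm]
  have hint : ∫ x, ⟪FunctionSpaces.Torus.laplacian ((Ω • crossCLM e₃) ∘ u) x, u x⟫ =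
      -∫ x, ⟪((Ω • crossCLM e₃) ∘ u) x, FunctionSpaces.Torus.laplacian u x⟫ := by
    rw [← integral_neg]
    exact integral_congr_ae (ae_of_all _ hskew)
  have h2 : ∫ x, ⟪((Ω • crossCLM e₃) ∘ u) x, FunctionSpaces.Torus.laplacian u x⟫ = 0 := by
    linarith [hG, hint]
  simpa only [Function.comp_apply, ← coriolisForce_eq_smul_crossCLM] using h2

namespace IsClassicalNSCoriolisSolutionOn

variable {S : Set ℝ} {ν Ω : ℝ} {f u : ℝ → UnitAddTorus (Fin 3) → EuclideanSpace ℝ (Fin 3)}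
  {p : ℝ → UnitAddTorus (Fin 3) → ℝ}

/-- Along a periodic classical solution of the rotating system, the Coriolis term is orthogonal
to `Δu(t)` at every time of `S`: it contributes nothing when the momentum equation is paired with
`−Δu` (the enstrophy / `H¹` balance of the rotating system is that of Navier–Stokes; BMN 1999,
p. 1140 and §5, where all `H^α` estimates are uniform in `Ω`). [cite: BabinMahalovNicolaenko1999, §2 p. 1140] -/
theorem integral_inner_coriolisForce_laplacian_eq_zero
    (h : IsClassicalNSCoriolisSolutionOn S ν Ω (fun t => FunctionSpaces.Torus.lift (f t))
      (fun t => FunctionSpaces.Torus.lift (u t)) (fun t => FunctionSpaces.Torus.lift (p t)))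
    {t : ℝ} (ht : t ∈ S) :
    ∫ x, ⟪coriolisForce Ω (u t x), FunctionSpaces.Torus.laplacian (u t) x⟫ = 0 :=
  Torus.integral_inner_coriolisForce_laplacian Ω (h.to_torus.smooth_velocity.isSmooth_slice ht)

end IsClassicalNSCoriolisSolutionOn

/-! ### All Sobolev levels: the Coriolis term is orthogonal to every power of the Laplacian -/

/-- **The Coriolis term is `L²(𝕋³)`-orthogonal to `Δⁿu` for every `n`** — the integer-`α`
content of BMN 1999, p. 1140: "as `PJP` is skew-symmetric and commutes with `A^α` for every
`α`, `E(−Ωt) = exp(−ΩPJPt)` preserves all Sobolev norms" (pairing the rotating momentum equation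
with `(−Δ)ⁿu` produces no `Ω`: the `Hⁿ` energy balances of the rotating system are those of
Navier–Stokes). Proof by two-step induction on `n`: `n = 0` is `⟪Ω e₃ × a, a⟫ = 0` pointwise
(`inner_coriolisForce_self`), `n = 1` is `Torus.integral_inner_coriolisForce_laplacian`, and
`∫ ⟪Ju, Δⁿ⁺²u⟫ = ∫ ⟪Δ(Ju), Δⁿ⁺¹u⟫ = ∫ ⟪J(Δu), Δⁿ(Δu)⟫` by Green's second identity
(`Torus.integral_inner_laplacian_comm`) and `Δ(J ∘ u) = J ∘ Δu` for the constant map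
`J = Ω e₃ ×` (`Torus.laplacian_clm_comp_apply`). [cite: BabinMahalovNicolaenko1999, §2 p. 1140] -/
theorem Torus.integral_inner_coriolisForce_laplacian_iterate (Ω : ℝ) (n : ℕ)
    {u : UnitAddTorus (Fin 3) → EuclideanSpace ℝ (Fin 3)} (hu : FunctionSpaces.Torus.IsSmooth u) :
    ∫ x, ⟪coriolisForce Ω (u x), (FunctionSpaces.Torus.laplacian^[n] u) x⟫ = 0 := by
  -- the statement for `n` and `n + 1` simultaneously, by induction on `n`
  have key : ∀ m : ℕ, ∀ {v : UnitAddTorus (Fin 3) → EuclideanSpace ℝ (Fin 3)},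
      FunctionSpaces.Torus.IsSmooth v →
      (∫ x, ⟪coriolisForce Ω (v x), (FunctionSpaces.Torus.laplacian^[m] v) x⟫ = 0) ∧
      (∫ x, ⟪coriolisForce Ω (v x), (FunctionSpaces.Torus.laplacian^[m + 1] v) x⟫ = 0) := by
    intro m
    induction m with
    | zero =>
      intro v hv
      refine ⟨?_, ?_⟩
      · simp only [Function.iterate_zero, id_eq, inner_coriolisForce_self, integral_zero]
      · rw [zero_add, Function.iterate_one]
        exact Torus.integral_inner_coriolisForce_laplacian Ω hv
    | succ m ih =>
      intro v hv
      refine ⟨(ih hv).2, ?_⟩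
      -- `∫ ⟪Jv, Δ^{m+2} v⟫ = ∫ ⟪Δ(Jv), Δ^{m+1} v⟫ = ∫ ⟪J(Δv), Δ^{m}(Δv)⟫ = 0` (`ih` for `Δv`)
      have hJv : FunctionSpaces.Torus.IsSmooth ((Ω • crossCLM e₃) ∘ v) := hv.comp_clm (Ω • crossCLM e₃)
      have hΔv : FunctionSpaces.Torus.IsSmooth (FunctionSpaces.Torus.laplacian v) := hv.laplacian
      have hw : FunctionSpaces.Torus.IsSmooth (FunctionSpaces.Torus.laplacian^[m + 1] v) :=
        FunctionSpaces.Torus.isSmooth_laplacian_iterate hv (m + 1)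
      have h1 : ∫ x, ⟪coriolisForce Ω (v x), (FunctionSpaces.Torus.laplacian^[m + 1 + 1] v) x⟫ =
          ∫ x, ⟪((Ω • crossCLM e₃) ∘ v) x,
            FunctionSpaces.Torus.laplacian (FunctionSpaces.Torus.laplacian^[m + 1] v) x⟫ := by
        refine integral_congr_ae (ae_of_all _ fun x => ?_)
        simp only [Function.comp_apply, coriolisForce_eq_smul_crossCLM, Function.iterate_succ_apply']
      have h2 := FunctionSpaces.Torus.integral_inner_laplacian_comm hJv hw
      have h3 : ∫ x, ⟪FunctionSpaces.Torus.laplacian ((Ω • crossCLM e₃) ∘ v) x,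
          (FunctionSpaces.Torus.laplacian^[m + 1] v) x⟫ =
          ∫ x, ⟪coriolisForce Ω (FunctionSpaces.Torus.laplacian v x),
            (FunctionSpaces.Torus.laplacian^[m] (FunctionSpaces.Torus.laplacian v)) x⟫ := by
        refine integral_congr_ae (ae_of_all _ fun x => ?_)
        simp only [FunctionSpaces.Torus.laplacian_clm_comp_apply hv, coriolisForce_eq_smul_crossCLM,
          Function.iterate_succ_apply]
      rw [h1, ← h2, h3]
      exact (ih hΔv).1
  exact (key n hu).1

namespace IsClassicalNSCoriolisSolutionOn

variable {S : Set ℝ} {ν Ω : ℝ} {f u : ℝ → UnitAddTorus (Fin 3) → EuclideanSpace ℝ (Fin 3)}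
  {p : ℝ → UnitAddTorus (Fin 3) → ℝ}

/-- Along a periodic classical solution of the rotating system, the Coriolis term is orthogonal
to `Δⁿu(t)` for every `n` at every time of `S`: none of the `Hⁿ` energy balances of the rotating
system sees `Ω` (BMN 1999, p. 1140 and §5). [cite: BabinMahalovNicolaenko1999, §2 p. 1140] -/
theorem integral_inner_coriolisForce_laplacian_iterate_eq_zero
    (h : IsClassicalNSCoriolisSolutionOn S ν Ω (fun t => FunctionSpaces.Torus.lift (f t))
      (fun t => FunctionSpaces.Torus.lift (u t)) (fun t => FunctionSpaces.Torus.lift (p t)))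
    {t : ℝ} (ht : t ∈ S) (n : ℕ) :
    ∫ x, ⟪coriolisForce Ω (u t x), (FunctionSpaces.Torus.laplacian^[n] (u t)) x⟫ = 0 :=
  Torus.integral_inner_coriolisForce_laplacian_iterate Ω n (h.to_torus.smooth_velocity.isSmooth_slice ht)

end IsClassicalNSCoriolisSolutionOn

end Literature.Analysis.FluidPDE

end
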